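import Summits.BirchSwinnertonDyer.BirchSwinnertonDyer.Theorems.ManinLocalTwoThreeShimuraIndexTwins
import Summits.BirchSwinnertonDyer.BirchSwinnertonDyer.Theorems.ManinLocalTwoThreeShimuraQuotientLevelInstances
import Summits.BirchSwinnertonDyer.BirchSwinnertonDyer.Theorems.ManinLocalTwoThreeEisensteinSieve
import Mathlib.RingTheory.ZMod.UnitsCyclic
import HarnessLib

/-!
# `[Λ₀(f) : Λ₁(f)] ∣ 2` FOR EVERY `X₀(N)`-DATUM AT THE LEVELS `N = u²v` WITH `(ℤ/uv)ˣ = ±⟨u₀⟩`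
# (`N = 4q^k, 8q^k, 16q^k`, `q` an odd prime; `N = 32, 64, 128, 256`): THE SHIMURA QUOTIENT IS `0` OR `ℤ/2`,
# THE ONE UNDECIDED BIT, ITS `q ≡ 3 (mod 4)` COLLAPSE AND ITS MOD-`2` EISENSTEIN SIGNATURE

Summit `BirchSwinnertonDyer`, route `ManinLocalTwoThree`, crux C2 `ManinOddAtFour` (stmt-BirchSwinnertonDyer-22967); cell bsd-f2-manin,
es lens, gen 46, turnkey T-es-110 (`--supports stmt-BirchSwinnertonDyer-22967`).  INDEX-LANGUAGE COROLLARIES of the tree's two-class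
lemmas: `Literature/…/PeriodLatticeGamma1QuotientProofs` (`exists_forall_units_eq_pow_or_eq_neg_pow_four_mul`, p631564) and the LEAD's
`…ShimuraQuotientCuspidalInertia` (`exists_forall_mem_or_sub_mem_periodLatticeGamma1_of_generator_mod`: at `N = u²v`, if the units of
`ℤ/uv` are `± u₀^k` and `2Λ₀ ⊆ Λ₁`, every period is `≡ 0` or `≡ {∞, γ₀∞}_f (mod Λ₁)`), which the LEAD used to EXCLUDE INDEX `4` for
LATTICE-OPTIMAL data (`…ShimuraQuotientLevelInstances`, `…ShimuraQuotientFourP`).  Here the same lemmas give, with NO optimality, twin,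
Hecke or modularity hypothesis, the sharper counting statement in the currency of T-es-107/108/109 (`AddSubgroup.relIndex`):

* §1 `relIndex_dvd_two_of_two_classes` (pure lattice lemma: two classes ⟹ `[Λ₀ : Λ₁] ∣ 2`) and **`relIndex_dvd_two_of_generator_mod`**:
  for EVERY `X₀(N)`-datum `D₀` at `N = u²v`, `4 ∣ N`, `(ℤ/uv)ˣ = ±⟨u₀⟩`: **`[Λ₀(f) : Λ₁(f)] ∣ 2`**.  Instances: `…_of_uv_eq_four_mul`
  (`uv = 4q`, `q` odd, `(ℤ/q)ˣ` cyclic), **`…_of_four_mul_prime_pow` (`N = 4q^k`), `…_of_eight_mul_prime_pow` (`8q^k`),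
  `…_of_sixteen_mul_prime_pow` (`16q^k`)**, `…_of_uv_eq_eight / _sixteen`, **`…_of_two_power` (`N ∈ {32, 64, 128, 256}`)**.
* §2 the dichotomy and its three readings, for any `f` with `[Λ₀ : Λ₁] ∣ 2`: `[Λ₀ : Λ₁] = 1 ∨ = 2`; `= 2 ↔ Λ₁ ≠ Λ₀ ↔ ¬ ShimuraIndexPrimeTo 2 f`;
  `Λ₁ = Λ₀ ↔ ShimuraIndexPrimeTo 2 f`; `ShimuraIndexPrimeTo p f` at every odd `p` (dictionary of `…ShimuraIndexTwins` §1).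
* §3 the two branches at `4 ∣ N`: `q ≡ 3 (mod 4)` ⟹ `[Λ₀ : Λ₁] = 1` at `N = 4q^k` (the LEAD's `periodLatticeGamma1_eq_of_four_mul_prime_pow`
  in index language); `[Λ₀ : Λ₁] ≠ 1 ⟹` every good `a_ℓ(W₀)` is EVEN (`even_coeff_of_relIndex_ne_one`, the LEAD's Eisenstein sieve in index
  language; for LATTICE-OPTIMAL data the tree has the stronger `shimuraTwoForcesRationalTwoTorsion_holds`, E-an-128₂: a rational `2`-torsion
  point); one odd good `a_ℓ` ⟹ `[Λ₀ : Λ₁] = 1`.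
* §4 inhabited instances at the E15 levels: `20, 24 ↦ 2` (T-es-107), `28 ↦ 1`, `40, 56, 80, 112, 32, 64, 128 ↦ ∣ 2`, `48 ↦ ∣ 2`
  (and `= 2` modulo the modularity binder, `…ShimuraIndexTwins` §3), `52, 116 ↦ ∈ {1, 2}`.

CENSUS FACE (E15-LATTICE-INDEX-v1, eclib, 1 025 optimal classes): `4q^k: {2: 16, 1: 32}`, `8q^k: {2: 2 (24a, 40a), 1: 43}`,
`16q^k: {2: 12, 1: 56}`, `2^e: {2: 4 (32a, 64a, 128b, 128d), 1: 6}` — all inside `{1, 2}` ✓ (0 violations); at the REMAINING levels with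
`4 ∣ N` (odd part with `≥ 2` primes, or `32 ∣ N` with odd part `> 1`), where `(ℤ/uv)ˣ/±1` is NOT cyclic and this file says nothing,
the census reads `{1: 152}` (cell rows E-imc-29 / E-an-152b: the index-`2` habitat below `5·10⁵` is `4(m²+4), 16(m²+4), 24, 40, 48, 80,
32, 64, 128` — all of them levels of §1).

HONEST FRAMING: printed mathematics (Ling–Oesterlé 1991 §1, Thm. 1, Thm. 6; Stevens 1989 §2), formal corollaries of tree lemmas; no new
mechanism; beyond-print theorem NO; which branch holds at `q ≡ 1 (mod 4)` (the cell's THEOREM S / E-imc-27…30 habitat `p = m² + 4`) is NOT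
decided here; Manin's `c = 1`, C2 and BSD are NOT proved.  Kernel-checked, standard axioms, no Literature fact consumed, no `sorry`, no
definitions.

References: [LingOesterle1991] §1, Thm. 1, Thm. 6; [Stevens1989] §2; [DiamondShurman2005] §1.2; [CremonaAlgorithms1997] §2.8, Table 1.
-/

set_option autoImplicit false
set_option linter.dupNamespace false

noncomputable section

open scoped Classical MatrixGroups

open CongruenceSubgroup
open WeierstrassCurve Literature.NumberTheory.EllipticCurves Literature.NumberTheory.EllipticCurves.ModularForms
open Summit.BirchSwinnertonDyer.Rank1Residual.ManinAdditive.KatoCurve (ShimuraIndexPrimeTo)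

namespace Summit.BirchSwinnertonDyer.BirchSwinnertonDyer.Theorems.ManinLocalTwoThree.ShimuraIndex

/-! ## §1 Two classes ⟹ `[Λ₀ : Λ₁] ∣ 2`; the levels `u²v` with `(ℤ/uv)ˣ = ±⟨u₀⟩` -/

section TwoClasses

variable {N : ℕ} (f : CuspForm (Gamma0 N) 2)

/-- **Pure lattice lemma**: if every `z ∈ Λ₀(f)` is `≡ 0` or `≡ x₀ (mod Λ₁(f))` for one fixed `x₀ ∈ ℂ`, then `[Λ₀(f) : Λ₁(f)] ∣ 2`
(the quotient `Λ₀/Λ₁` is the image of a two-element set). -/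
theorem relIndex_dvd_two_of_two_classes {x₀ : ℂ}
    (htwo : ∀ z ∈ periodLattice f, z ∈ periodLatticeGamma1 f ∨ z - x₀ ∈ periodLatticeGamma1 f) :
    (periodLatticeGamma1 f).relIndex (periodLattice f) ∣ 2 := by
  set H : AddSubgroup (periodLattice f) := (periodLatticeGamma1 f).addSubgroupOf (periodLattice f) with hH
  have hidx : (periodLatticeGamma1 f).relIndex (periodLattice f) = Nat.card (periodLattice f ⧸ H) := by
    rw [← AddSubgroup.index_eq_card]; rfl
  -- a surjection from `Bool`
  obtain ⟨g, hg⟩ : ∃ g : Bool → periodLattice f ⧸ H, Function.Surjective g := by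
    by_cases hall : ∀ z ∈ periodLattice f, z ∈ periodLatticeGamma1 f
    · refine ⟨fun _ ↦ 0, fun q ↦ ⟨true, ?_⟩⟩
      obtain ⟨z, rfl⟩ := QuotientAddGroup.mk_surjective q
      symm
      rw [QuotientAddGroup.eq_zero_iff, hH, AddSubgroup.mem_addSubgroupOf]
      exact hall _ z.2
    · push Not at hall
      obtain ⟨z₁, hz₁, hz₁'⟩ := hall
      have hz₁x : z₁ - x₀ ∈ periodLatticeGamma1 f := (htwo z₁ hz₁).resolve_left hz₁'
      refine ⟨fun b ↦ cond b (QuotientAddGroup.mk ⟨z₁, hz₁⟩) 0, fun q ↦ ?_⟩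
      obtain ⟨z, rfl⟩ := QuotientAddGroup.mk_surjective q
      rcases htwo z z.2 with h | h
      · refine ⟨false, ?_⟩
        show (0 : periodLattice f ⧸ H) = QuotientAddGroup.mk z
        symm
        rw [QuotientAddGroup.eq_zero_iff, hH, AddSubgroup.mem_addSubgroupOf]
        exact h
      · refine ⟨true, ?_⟩
        show (QuotientAddGroup.mk ⟨z₁, hz₁⟩ : periodLattice f ⧸ H) = QuotientAddGroup.mk z
        rw [QuotientAddGroup.eq, hH, AddSubgroup.mem_addSubgroupOf]
        have e : ((-(⟨z₁, hz₁⟩ : periodLattice f) + z : periodLattice f) : ℂ) = (z - x₀) - (z₁ - x₀) := by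
          push_cast; ring
        rw [e]
        exact sub_mem h hz₁x
  haveI : Finite (periodLattice f ⧸ H) := Finite.of_surjective g hg
  have hle : Nat.card (periodLattice f ⧸ H) ≤ 2 := by
    have h := Nat.card_le_card_of_surjective g hg
    simpa using h
  have hpos : 0 < Nat.card (periodLattice f ⧸ H) := Nat.card_pos
  rw [hidx]
  interval_cases (Nat.card (periodLattice f ⧸ H)) <;> norm_num

end TwoClasses

variable {W₀ : WeierstrassCurve ℚ}

/-- **`[Λ₀(f) : Λ₁(f)] ∣ 2` for EVERY `X₀(N)`-datum at `N = u²v`, `4 ∣ N`, when the units of `ℤ/uv` are `± u₀^k`**: `2Λ₀ ⊆ Λ₁`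
(traceless `2`, `two_mul_mem_periodLatticeGamma1_of_four_dvd`) and the generator hypothesis give the two classes `0, {∞, γ₀∞}_f`
(`exists_forall_mem_or_sub_mem_periodLatticeGamma1_of_generator_mod`); then §1's lattice lemma.  No optimality hypothesis.
[cite: LingOesterle1991, §1 and Thm. 6] [cite: Stevens1989, §2] -/
theorem relIndex_dvd_two_of_generator_mod {N u v m : ℕ} [NeZero N] (hu : u ≠ 0) (hN : (N : ℤ) = (u : ℤ) ^ 2 * v) (hm : u * v = m)
    {u₀ : ZMod m} (hu₀ : IsUnit u₀) (hgen : ∀ w : (ZMod m)ˣ, ∃ k : ℕ, (w : ZMod m) = u₀ ^ k ∨ (w : ZMod m) = -(u₀ ^ k))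
    (D₀ : ModularParametrizationData W₀ N) (h4 : 2 ^ 2 ∣ N) : (periodLatticeGamma1 D₀.f).relIndex (periodLattice D₀.f) ∣ 2 := by
  subst hm
  obtain ⟨γ₀, hγ₀⟩ := exists_forall_mem_or_sub_mem_periodLatticeGamma1_of_generator_mod D₀.f hu hN hu₀ hgen
    (fun z hz ↦ two_mul_mem_periodLatticeGamma1_of_four_dvd D₀ h4 hz)
  exact relIndex_dvd_two_of_two_classes D₀.f hγ₀

/-- `[Λ₀ : Λ₁] ∣ 2` at `N = u²v`, `4 ∣ N`, `(ℤ/uv)ˣ` CYCLIC (`uv ∈ {4, q^j, 2q^j}`). [cite: LingOesterle1991, §1 and Thm. 6] -/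
theorem relIndex_dvd_two_of_isCyclic_mod {N u v m : ℕ} [NeZero N] (hu : u ≠ 0) (hN : (N : ℤ) = (u : ℤ) ^ 2 * v) (hm : u * v = m)
    [NeZero m] [IsCyclic (ZMod m)ˣ] (D₀ : ModularParametrizationData W₀ N) (h4 : 2 ^ 2 ∣ N) :
    (periodLatticeGamma1 D₀.f).relIndex (periodLattice D₀.f) ∣ 2 := by
  obtain ⟨u₀, hu₀, hgen⟩ := exists_forall_units_eq_pow_or_eq_neg_pow_of_isCyclic (m := m)
  exact relIndex_dvd_two_of_generator_mod hu hN hm hu₀ hgen D₀ h4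

/-- **`[Λ₀ : Λ₁] ∣ 2` at `N = u²v` with `uv = 4q`, `q` odd, `(ℤ/q)ˣ` cyclic** (the units of `ℤ/4q` are `± u₀^k` by CRT,
`exists_forall_units_eq_pow_or_eq_neg_pow_four_mul`): the levels `4q^j` (`u = 1` or `u = q^a`), `8q^j` (`u = 2q^a`), `16q^j`
(`u = 4q^a`). [cite: LingOesterle1991, §1, Thm. 1, Thm. 6] [cite: DiamondShurman2005, §1.2] -/
theorem relIndex_dvd_two_of_uv_eq_four_mul {N u v q : ℕ} [NeZero N] (hu : u ≠ 0) (hN : (N : ℤ) = (u : ℤ) ^ 2 * v)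
    (huv : u * v = 4 * q) (hq : Odd q) [IsCyclic (ZMod q)ˣ] (D₀ : ModularParametrizationData W₀ N) :
    (periodLatticeGamma1 D₀.f).relIndex (periodLattice D₀.f) ∣ 2 := by
  obtain ⟨u₀, hu₀, hgen⟩ := exists_forall_units_eq_pow_or_eq_neg_pow_four_mul hq
  have h4uv : 2 ^ 2 ∣ u * v := ⟨q, by rw [huv]; ring⟩
  have h4 : 2 ^ 2 ∣ N := h4uv.trans (mul_dvd_of_sq_mul hN)
  exact relIndex_dvd_two_of_generator_mod hu hN huv hu₀ hgen D₀ h4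

/-- **`N = 4v`, `v` odd, `(ℤ/v)ˣ` cyclic: `[Λ₀(f) : Λ₁(f)] ∣ 2`** for every datum (`u = 1`). [cite: LingOesterle1991, Thm. 1] -/
theorem relIndex_dvd_two_of_four_mul {N v : ℕ} [NeZero N] (hv : Odd v) [IsCyclic (ZMod v)ˣ] (hN : N = 4 * v)
    (D₀ : ModularParametrizationData W₀ N) : (periodLatticeGamma1 D₀.f).relIndex (periodLattice D₀.f) ∣ 2 :=
  relIndex_dvd_two_of_uv_eq_four_mul (u := 1) (v := 4 * v) one_ne_zero (by subst hN; push_cast; ring) (one_mul _) hv D₀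

/-- **`N = 4q^k`, `q` an odd prime: `[Λ₀(f) : Λ₁(f)] ∣ 2`** for every `X₀(N)`-datum (`(ℤ/q^k)ˣ` is cyclic,
`ZMod.isCyclic_units_of_prime_pow`).  Levels `20, 52, 116, 212, …` (index `2` occurs), `28, 44, 76, …` (index `1`, §3), `36, 100, 108,
196, 324, 484, 500, …`. [cite: LingOesterle1991, §1, Thm. 1] -/
theorem relIndex_dvd_two_of_four_mul_prime_pow {N q k : ℕ} [NeZero N] (hq : q.Prime) (hq2 : q ≠ 2) (hN : N = 4 * q ^ k)
    (D₀ : ModularParametrizationData W₀ N) : (periodLatticeGamma1 D₀.f).relIndex (periodLattice D₀.f) ∣ 2 := by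
  haveI := ZMod.isCyclic_units_of_prime_pow q hq hq2 k
  exact relIndex_dvd_two_of_four_mul ((hq.odd_of_ne_two hq2).pow) hN D₀

/-- `N = 4q`, `q` an odd prime: `[Λ₀(f) : Λ₁(f)] ∣ 2`. -/
theorem relIndex_dvd_two_of_four_mul_prime {N q : ℕ} [NeZero N] (hq : q.Prime) (hq2 : q ≠ 2) (hN : N = 4 * q)
    (D₀ : ModularParametrizationData W₀ N) : (periodLatticeGamma1 D₀.f).relIndex (periodLattice D₀.f) ∣ 2 :=
  relIndex_dvd_two_of_four_mul_prime_pow (k := 1) hq hq2 (by rw [hN, pow_one]) D₀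

/-- **`N = 8q^k`, `q` an odd prime: `[Λ₀(f) : Λ₁(f)] ∣ 2`** for every datum (`u = 2`, `v = 2q^k`, `uv = 4q^k`).  Levels
`24, 40 ↦ 2` and `56, 88, 104, 136, 152, 184, 232, 248, … ↦ 1` in E15. [cite: LingOesterle1991, Thm. 6] -/
theorem relIndex_dvd_two_of_eight_mul_prime_pow {N q k : ℕ} [NeZero N] (hq : q.Prime) (hq2 : q ≠ 2) (hN : N = 8 * q ^ k)
    (D₀ : ModularParametrizationData W₀ N) : (periodLatticeGamma1 D₀.f).relIndex (periodLattice D₀.f) ∣ 2 := by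
  haveI := ZMod.isCyclic_units_of_prime_pow q hq hq2 k
  exact relIndex_dvd_two_of_uv_eq_four_mul (u := 2) (v := 2 * q ^ k) (q := q ^ k) two_ne_zero (by subst hN; push_cast; ring)
    (by ring) ((hq.odd_of_ne_two hq2).pow) D₀

/-- **`N = 16q^k`, `q` an odd prime: `[Λ₀(f) : Λ₁(f)] ∣ 2`** for every datum (`u = 4`, `v = q^k`, `uv = 4q^k`).  Levels
`48, 80, 208, 464, 848, … ↦ 2` and `112, 176, 272, 304, … ↦ 1` in E15. [cite: LingOesterle1991, Thm. 6] -/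
theorem relIndex_dvd_two_of_sixteen_mul_prime_pow {N q k : ℕ} [NeZero N] (hq : q.Prime) (hq2 : q ≠ 2) (hN : N = 16 * q ^ k)
    (D₀ : ModularParametrizationData W₀ N) : (periodLatticeGamma1 D₀.f).relIndex (periodLattice D₀.f) ∣ 2 := by
  haveI := ZMod.isCyclic_units_of_prime_pow q hq hq2 k
  exact relIndex_dvd_two_of_uv_eq_four_mul (u := 4) (v := q ^ k) (q := q ^ k) (by norm_num) (by subst hN; push_cast; ring)
    (by ring) ((hq.odd_of_ne_two hq2).pow) D₀

/-- `[Λ₀ : Λ₁] ∣ 2` at `N = u²v` with `uv = 8` (`N ∈ {32, 64}`): the units of `ℤ/8` are `± 3^k`. [cite: LingOesterle1991, Thm. 6] -/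
theorem relIndex_dvd_two_of_uv_eq_eight {N u v : ℕ} [NeZero N] (hu : u ≠ 0) (hN : (N : ℤ) = (u : ℤ) ^ 2 * v) (huv : u * v = 8)
    (D₀ : ModularParametrizationData W₀ N) : (periodLatticeGamma1 D₀.f).relIndex (periodLattice D₀.f) ∣ 2 := by
  have h4uv : 2 ^ 2 ∣ u * v := ⟨2, by rw [huv]; norm_num⟩
  have h4 : 2 ^ 2 ∣ N := h4uv.trans (mul_dvd_of_sq_mul hN)
  have h3 : IsUnit (3 : ZMod 8) := by decide
  exact relIndex_dvd_two_of_generator_mod hu hN huv h3 forall_units_zmod_eight D₀ h4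

/-- `[Λ₀ : Λ₁] ∣ 2` at `N = u²v` with `uv = 16` (`N ∈ {32, 64, 128, 256}`): the units of `ℤ/16` are `± 3^k`.
[cite: LingOesterle1991, Thm. 6] -/
theorem relIndex_dvd_two_of_uv_eq_sixteen {N u v : ℕ} [NeZero N] (hu : u ≠ 0) (hN : (N : ℤ) = (u : ℤ) ^ 2 * v) (huv : u * v = 16)
    (D₀ : ModularParametrizationData W₀ N) : (periodLatticeGamma1 D₀.f).relIndex (periodLattice D₀.f) ∣ 2 := by
  have h4uv : 2 ^ 2 ∣ u * v := ⟨4, by rw [huv]; norm_num⟩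
  have h4 : 2 ^ 2 ∣ N := h4uv.trans (mul_dvd_of_sq_mul hN)
  have h3 : IsUnit (3 : ZMod 16) := by decide
  exact relIndex_dvd_two_of_generator_mod hu hN huv h3 forall_units_zmod_sixteen D₀ h4

/-- **`[Λ₀ : Λ₁] ∣ 2` at the pure `2`-power conductors `N = 32, 64, 128, 256`** (every datum; E15: `32a, 64a, 128b, 128d ↦ 2`,
`64b?, 128a, 128c, 256a–d ↦ 1`). [cite: LingOesterle1991, Thm. 6] [cite: Stevens1989, §2] -/
theorem relIndex_dvd_two_of_two_power {N : ℕ} [NeZero N] (hN : N = 32 ∨ N = 64 ∨ N = 128 ∨ N = 256)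
    (D₀ : ModularParametrizationData W₀ N) : (periodLatticeGamma1 D₀.f).relIndex (periodLattice D₀.f) ∣ 2 := by
  rcases hN with rfl | rfl | rfl | rfl
  · exact relIndex_dvd_two_of_uv_eq_eight (u := 4) (v := 2) (by norm_num) (by norm_num) (by norm_num) D₀
  · exact relIndex_dvd_two_of_uv_eq_eight (u := 8) (v := 1) (by norm_num) (by norm_num) (by norm_num) D₀
  · exact relIndex_dvd_two_of_uv_eq_sixteen (u := 8) (v := 2) (by norm_num) (by norm_num) (by norm_num) D₀
  · exact relIndex_dvd_two_of_uv_eq_sixteen (u := 16) (v := 1) (by norm_num) (by norm_num) (by norm_num) D₀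

/-! ## §2 The dichotomy `[Λ₀ : Λ₁] ∈ {1, 2}` and its three readings -/

section Dichotomy

variable {N : ℕ} [NeZero N] (f : CuspForm (Gamma0 N) 2)

omit [NeZero N] in
/-- `[Λ₀ : Λ₁] ∣ 2 ⟹ [Λ₀ : Λ₁] = 1 ∨ [Λ₀ : Λ₁] = 2`. -/
theorem relIndex_eq_one_or_two_of_dvd_two (h : (periodLatticeGamma1 f).relIndex (periodLattice f) ∣ 2) :
    (periodLatticeGamma1 f).relIndex (periodLattice f) = 1 ∨ (periodLatticeGamma1 f).relIndex (periodLattice f) = 2 :=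
  (Nat.dvd_prime Nat.prime_two).mp h

omit [NeZero N] in
/-- Reading 1: **`[Λ₀ : Λ₁] = 2 ↔ Λ₁(f) ≠ Λ₀(f)`** (when `[Λ₀ : Λ₁] ∣ 2`). -/
theorem relIndex_eq_two_iff_ne_of_dvd_two (h : (periodLatticeGamma1 f).relIndex (periodLattice f) ∣ 2) :
    (periodLatticeGamma1 f).relIndex (periodLattice f) = 2 ↔ periodLatticeGamma1 f ≠ periodLattice f := by
  rw [Ne, ← relIndex_eq_one_iff f]
  rcases relIndex_eq_one_or_two_of_dvd_two f h with h' | h' <;> simp [h']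

/-- Reading 2: **`[Λ₀ : Λ₁] = 2 ↔ ¬ ShimuraIndexPrimeTo 2 f`** (the Shimura quotient has `2`-torsion). [cite: LingOesterle1991, §1] -/
theorem relIndex_eq_two_iff_not_shimuraIndexPrimeTo_two_of_dvd_two (h : (periodLatticeGamma1 f).relIndex (periodLattice f) ∣ 2) :
    (periodLatticeGamma1 f).relIndex (periodLattice f) = 2 ↔ ¬ ShimuraIndexPrimeTo 2 f := by
  rw [← dvd_relIndex_iff_not_shimuraIndexPrimeTo f Nat.prime_two]
  rcases relIndex_eq_one_or_two_of_dvd_two f h with h' | h' <;> simp [h']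

/-- Reading 3: **`Λ₁(f) = Λ₀(f) ↔ ShimuraIndexPrimeTo 2 f`** — «Stevens' curve = the optimal curve» is exactly the absence of
`2`-torsion in the Shimura quotient (when `[Λ₀ : Λ₁] ∣ 2`). -/
theorem periodLatticeGamma1_eq_iff_shimuraIndexPrimeTo_two_of_dvd_two (h : (periodLatticeGamma1 f).relIndex (periodLattice f) ∣ 2) :
    periodLatticeGamma1 f = periodLattice f ↔ ShimuraIndexPrimeTo 2 f := by
  have h' := relIndex_eq_two_iff_not_shimuraIndexPrimeTo_two_of_dvd_two f h
  rw [relIndex_eq_two_iff_ne_of_dvd_two f h] at h'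
  tauto

/-- When `[Λ₀ : Λ₁] ∣ 2`, EVERY ODD prime is prime to the Shimura index: `ShimuraIndexPrimeTo p f`, `p ≠ 2`. -/
theorem shimuraIndexPrimeTo_odd_of_dvd_two (h : (periodLatticeGamma1 f).relIndex (periodLattice f) ∣ 2) {p : ℕ} (hp : p.Prime)
    (hp2 : p ≠ 2) : ShimuraIndexPrimeTo p f := by
  rw [shimuraIndexPrimeTo_iff_not_dvd_relIndex f hp]
  intro hdvd
  exact hp2 ((Nat.prime_dvd_prime_iff_eq hp Nat.prime_two).mp (Nat.dvd_trans hdvd h))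

end Dichotomy

/-- The dichotomy at `N = 4q^k`, `q` an odd prime, for every datum. -/
theorem relIndex_eq_one_or_two_of_four_mul_prime_pow {N q k : ℕ} [NeZero N] (hq : q.Prime) (hq2 : q ≠ 2) (hN : N = 4 * q ^ k)
    (D₀ : ModularParametrizationData W₀ N) :
    (periodLatticeGamma1 D₀.f).relIndex (periodLattice D₀.f) = 1 ∨ (periodLatticeGamma1 D₀.f).relIndex (periodLattice D₀.f) = 2 :=
  relIndex_eq_one_or_two_of_dvd_two D₀.f (relIndex_dvd_two_of_four_mul_prime_pow hq hq2 hN D₀)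

/-- At `N = 4q^k`: `[Λ₀ : Λ₁] = 2 ↔ Λ₁ ≠ Λ₀` — so the cell's lattice shadow E-imc-30 («odd congruence number ⟹ `Λ₁ ≠ Λ₀`») already pins
the quotient to `ℤ/2` at the family levels `4(m² + 4)`. -/
theorem relIndex_eq_two_iff_ne_of_four_mul_prime_pow {N q k : ℕ} [NeZero N] (hq : q.Prime) (hq2 : q ≠ 2) (hN : N = 4 * q ^ k)
    (D₀ : ModularParametrizationData W₀ N) :
    (periodLatticeGamma1 D₀.f).relIndex (periodLattice D₀.f) = 2 ↔ periodLatticeGamma1 D₀.f ≠ periodLattice D₀.f :=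
  relIndex_eq_two_iff_ne_of_dvd_two D₀.f (relIndex_dvd_two_of_four_mul_prime_pow hq hq2 hN D₀)

/-- At `N = 4q^k`: `Λ₁ = Λ₀ ↔ ShimuraIndexPrimeTo 2 f`. -/
theorem periodLatticeGamma1_eq_iff_shimuraIndexPrimeTo_two_of_four_mul_prime_pow {N q k : ℕ} [NeZero N] (hq : q.Prime)
    (hq2 : q ≠ 2) (hN : N = 4 * q ^ k) (D₀ : ModularParametrizationData W₀ N) :
    periodLatticeGamma1 D₀.f = periodLattice D₀.f ↔ ShimuraIndexPrimeTo 2 D₀.f :=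
  periodLatticeGamma1_eq_iff_shimuraIndexPrimeTo_two_of_dvd_two D₀.f (relIndex_dvd_two_of_four_mul_prime_pow hq hq2 hN D₀)

/-- At `N ∈ {4q^k, 8q^k, 16q^k}` every ODD prime is prime to the Shimura index. -/
theorem shimuraIndexPrimeTo_odd_of_pow_two_mul_prime_pow {N q k p : ℕ} [NeZero N] (hq : q.Prime) (hq2 : q ≠ 2)
    (hN : N = 4 * q ^ k ∨ N = 8 * q ^ k ∨ N = 16 * q ^ k) (D₀ : ModularParametrizationData W₀ N) (hp : p.Prime) (hp2 : p ≠ 2) :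
    ShimuraIndexPrimeTo p D₀.f := by
  refine shimuraIndexPrimeTo_odd_of_dvd_two D₀.f ?_ hp hp2
  rcases hN with hN | hN | hN
  · exact relIndex_dvd_two_of_four_mul_prime_pow hq hq2 hN D₀
  · exact relIndex_dvd_two_of_eight_mul_prime_pow hq hq2 hN D₀
  · exact relIndex_dvd_two_of_sixteen_mul_prime_pow hq hq2 hN D₀

/-! ## §3 The two branches: `q ≡ 3 (mod 4)` collapses; the index-`2` branch is `2`-Eisenstein -/

/-- **`q ≡ 3 (mod 4)`: `[Λ₀ : Λ₁] = 1`** at `N = 4q^k`, `k ≠ 0` (the LEAD's `periodLatticeGamma1_eq_of_four_mul_prime_pow` in index language: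
`(ℤ/2q^k)ˣ/{±1}` has odd order).  Levels `28, 44, 76, 92, 108, 124, 172, 188, 236, …`; E15: `14/14` classes at `N = 4q`, `q ≡ 3 (mod 4)`
have index `1` ✓. [cite: LingOesterle1991, Thm. 1] [cite: Stevens1989, §2] -/
theorem relIndex_eq_one_of_four_mul_prime_pow {N q k : ℕ} [NeZero N] (hq : q.Prime) (hq3 : q % 4 = 3) (hk : k ≠ 0)
    (hN : N = 4 * q ^ k) (D₀ : ModularParametrizationData W₀ N) : (periodLatticeGamma1 D₀.f).relIndex (periodLattice D₀.f) = 1 :=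
  (relIndex_eq_one_iff D₀.f).mpr (periodLatticeGamma1_eq_of_four_mul_prime_pow hq hq3 hk hN D₀)

/-- **The index-`≠ 1` branch is `2`-Eisenstein**: at any level with `4 ∣ N`, `[Λ₀(f) : Λ₁(f)] ≠ 1 ⇒ a_ℓ(W₀)` is EVEN at every good
prime `ℓ` — the contrapositive of the LEAD's Eisenstein sieve `periodLatticeGamma1_eq_of_sq_dvd_of_not_dvd_eisenstein` (an odd
`a_ℓ − ℓ − 1` forces `Λ₁ = Λ₀`); so `W₀[2]` is a reducible Galois module.  (For LATTICE-OPTIMAL data the tree's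
`shimuraTwoForcesRationalTwoTorsion_holds`, E-an-128₂, gives a rational `2`-torsion point.) [cite: Stevens1989, §2] -/
theorem even_coeff_of_relIndex_ne_one {N ℓ : ℕ} [NeZero N] (h4 : 2 ^ 2 ∣ N) (hℓ : ℓ.Prime) (hℓN : ¬ ℓ ∣ N)
    (D₀ : ModularParametrizationData W₀ N) (hidx : (periodLatticeGamma1 D₀.f).relIndex (periodLattice D₀.f) ≠ 1) :
    Even (W₀.LFunction ℓ) := by
  by_contra hodd
  rw [Int.not_even_iff_odd] at hodd
  apply hidx
  rw [relIndex_eq_one_iff D₀.f]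
  refine periodLatticeGamma1_eq_of_sq_dvd_of_not_dvd_eisenstein Nat.prime_two h4 hℓ hℓN D₀ ?_
  have hℓ2 : ℓ ≠ 2 := by
    rintro rfl; exact hℓN ((dvd_pow_self 2 two_ne_zero).trans h4)
  have hℓodd : Odd (ℓ : ℤ) := by exact_mod_cast hℓ.odd_of_ne_two hℓ2
  have e : W₀.LFunction ℓ - ℓ - 1 = W₀.LFunction ℓ - (ℓ + 1) := by ring
  have hodd' : Odd (W₀.LFunction ℓ - ℓ - 1) := by rw [e]; exact hodd.sub_even (hℓodd.add_one)
  rw [← Int.not_even_iff_odd, even_iff_two_dvd] at hodd'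
  exact_mod_cast hodd'

/-- `4 ∣ N`: **`[Λ₀ : Λ₁] = 2 ⇒` every good `a_ℓ(W₀)` is even.** -/
theorem even_coeff_of_relIndex_eq_two {N ℓ : ℕ} [NeZero N] (h4 : 2 ^ 2 ∣ N) (hℓ : ℓ.Prime) (hℓN : ¬ ℓ ∣ N)
    (D₀ : ModularParametrizationData W₀ N) (hidx : (periodLatticeGamma1 D₀.f).relIndex (periodLattice D₀.f) = 2) :
    Even (W₀.LFunction ℓ) :=
  even_coeff_of_relIndex_ne_one h4 hℓ hℓN D₀ (by rw [hidx]; norm_num)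

/-- Contrapositive, index language: at `4 ∣ N`, ONE odd good coefficient `a_ℓ(W₀)` gives `[Λ₀ : Λ₁] = 1` (at the levels of §1 it
DECIDES the bit). -/
theorem relIndex_eq_one_of_odd_coeff {N ℓ : ℕ} [NeZero N] (h4 : 2 ^ 2 ∣ N) (hℓ : ℓ.Prime) (hℓN : ¬ ℓ ∣ N)
    (D₀ : ModularParametrizationData W₀ N) (hodd : Odd (W₀.LFunction ℓ)) :
    (periodLatticeGamma1 D₀.f).relIndex (periodLattice D₀.f) = 1 := by
  by_contra h
  exact (Int.not_even_iff_odd.mpr hodd) (even_coeff_of_relIndex_ne_one h4 hℓ hℓN D₀ h)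

/-! ## §4 Inhabited instances at the E15 levels -/

/-- `N = 20 = 4·5`: `[Λ₀ : Λ₁] = 2` for every datum (T-es-107 `relIndex_twenty`; E15 `20a1 ↦ 2`). -/
theorem relIndex_eq_two_twenty_datum {W : WeierstrassCurve ℚ} [W.IsElliptic] (D : ModularParametrizationData W 20) :
    (periodLatticeGamma1 D.f).relIndex (periodLattice D.f) = 2 :=
  relIndex_twenty D.f D.isNewformOf.1.ne_zero

/-- `N = 24 = 8·3`: `[Λ₀ : Λ₁] = 2` for every datum (T-es-107 `relIndex_twentyFour`; E15 `24a1 ↦ 2`). -/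
theorem relIndex_eq_two_twentyFour_datum {W : WeierstrassCurve ℚ} [W.IsElliptic] (D : ModularParametrizationData W 24) :
    (periodLatticeGamma1 D.f).relIndex (periodLattice D.f) = 2 :=
  relIndex_twentyFour D.f D.isNewformOf.1.ne_zero

/-- `N = 28 = 4·7`: `[Λ₀ : Λ₁] = 1` for every datum (`7 ≡ 3 (mod 4)`). -/
theorem relIndex_eq_one_twentyEight_datum {W : WeierstrassCurve ℚ} [W.IsElliptic] (D : ModularParametrizationData W 28) :
    (periodLatticeGamma1 D.f).relIndex (periodLattice D.f) = 1 :=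
  relIndex_eq_one_of_four_mul_prime_pow (q := 7) (k := 1) (by norm_num) (by norm_num) one_ne_zero (by norm_num) D

/-- `N = 40 = 8·5` (genus `3`, no newform pinned in the tree): `[Λ₀ : Λ₁] ∣ 2` for every datum (E15 `40a1 ↦ 2`). -/
theorem relIndex_dvd_two_forty_datum {W : WeierstrassCurve ℚ} [W.IsElliptic] (D : ModularParametrizationData W 40) :
    (periodLatticeGamma1 D.f).relIndex (periodLattice D.f) ∣ 2 :=
  relIndex_dvd_two_of_eight_mul_prime_pow (q := 5) (k := 1) (by norm_num) (by norm_num) (by norm_num) D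

/-- `N = 48 = 16·3`: `[Λ₀ : Λ₁] ∣ 2` for every datum, unconditionally (and `= 2` modulo the modularity binder,
`relIndex_eq_two_fortyEight` of `…ShimuraIndexTwins`; E15 `48a1 ↦ 2`). -/
theorem relIndex_dvd_two_fortyEight_datum {W : WeierstrassCurve ℚ} [W.IsElliptic] (D : ModularParametrizationData W 48) :
    (periodLatticeGamma1 D.f).relIndex (periodLattice D.f) ∣ 2 :=
  relIndex_dvd_two_of_sixteen_mul_prime_pow (q := 3) (k := 1) (by norm_num) (by norm_num) (by norm_num) D

/-- `N = 52 = 4·13`: `[Λ₀ : Λ₁] ∈ {1, 2}` unconditionally; the level-`52` Hecke datum selects `2` (T-es-107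
`relIndex_fiftyTwo_of_heckeDatum`; E15 `52a1 ↦ 2`, `E₀(ℚ)[2] = ℤ/2`, `13 = 3² + 4`). -/
theorem relIndex_eq_one_or_two_fiftyTwo_datum {W : WeierstrassCurve ℚ} [W.IsElliptic] (D : ModularParametrizationData W 52) :
    (periodLatticeGamma1 D.f).relIndex (periodLattice D.f) = 1 ∨ (periodLatticeGamma1 D.f).relIndex (periodLattice D.f) = 2 :=
  relIndex_eq_one_or_two_of_four_mul_prime_pow (q := 13) (k := 1) (by norm_num) (by norm_num) (by norm_num) D

/-- `N = 56 = 8·7` (E15 `56a, 56b ↦ 1`): `[Λ₀ : Λ₁] ∣ 2` for every datum. -/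
theorem relIndex_dvd_two_fiftySix_datum {W : WeierstrassCurve ℚ} [W.IsElliptic] (D : ModularParametrizationData W 56) :
    (periodLatticeGamma1 D.f).relIndex (periodLattice D.f) ∣ 2 :=
  relIndex_dvd_two_of_eight_mul_prime_pow (q := 7) (k := 1) (by norm_num) (by norm_num) (by norm_num) D

/-- `N = 64 = 8²` (E15 `64a ↦ 2`): `[Λ₀ : Λ₁] ∣ 2` for every datum. -/
theorem relIndex_dvd_two_sixtyFour_datum {W : WeierstrassCurve ℚ} [W.IsElliptic] (D : ModularParametrizationData W 64) :
    (periodLatticeGamma1 D.f).relIndex (periodLattice D.f) ∣ 2 :=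
  relIndex_dvd_two_of_two_power (Or.inr (Or.inl rfl)) D

/-- `N = 80 = 16·5` (genus `7`; E15 `80a, 80b ↦ 2`): `[Λ₀ : Λ₁] ∣ 2` for every datum. -/
theorem relIndex_dvd_two_eighty_datum {W : WeierstrassCurve ℚ} [W.IsElliptic] (D : ModularParametrizationData W 80) :
    (periodLatticeGamma1 D.f).relIndex (periodLattice D.f) ∣ 2 :=
  relIndex_dvd_two_of_sixteen_mul_prime_pow (q := 5) (k := 1) (by norm_num) (by norm_num) (by norm_num) D

/-- `N = 116 = 4·29` (E15: `116a, 116b ↦ 1`, `116c ↦ 2`, `29 = 5² + 4`): `[Λ₀ : Λ₁] ∈ {1, 2}` for every datum. -/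
theorem relIndex_eq_one_or_two_oneSixteen_datum {W : WeierstrassCurve ℚ} [W.IsElliptic] (D : ModularParametrizationData W 116) :
    (periodLatticeGamma1 D.f).relIndex (periodLattice D.f) = 1 ∨ (periodLatticeGamma1 D.f).relIndex (periodLattice D.f) = 2 :=
  relIndex_eq_one_or_two_of_four_mul_prime_pow (q := 29) (k := 1) (by norm_num) (by norm_num) (by norm_num) D

/-- `N = 128 = 8²·2` (E15 `128b, 128d ↦ 2`, `128a, 128c ↦ 1`): `[Λ₀ : Λ₁] ∣ 2` for every datum. -/
theorem relIndex_dvd_two_oneTwentyEight_datum {W : WeierstrassCurve ℚ} [W.IsElliptic] (D : ModularParametrizationData W 128) :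
    (periodLatticeGamma1 D.f).relIndex (periodLattice D.f) ∣ 2 :=
  relIndex_dvd_two_of_two_power (Or.inr (Or.inr (Or.inl rfl))) D

end Summit.BirchSwinnertonDyer.BirchSwinnertonDyer.Theorems.ManinLocalTwoThree.ShimuraIndex
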